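import Literature.Analysis.FluidPDE.PalasekObukhovBlowup
import HarnessLib

/-!
# Palasek 2024: non-uniqueness in the Leray–Hopf class for the (unforced) dyadic Obukhov model

Analysis/FluidPDE Literature file in the `PalasekObukhov/` story (the tree's vocabulary for
Palasek's Obukhov shell model: `Literature.Analysis.FluidPDE.PalasekObukhov.obukhovRHS`,
`PalasekObukhovBlowup.lean`). One definition with body (Leray–Hopf solutions of the UNFORCED model,
Def. 1.1 of the source), ONE named fact `Palasek2024_lerayHopfNonuniqueness` (Thm. 1.2 with the
printed extra of Rem. 1.4, first sentence), and a proved reformulation. Source: S. Palasek,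
*Non-uniqueness in the Leray–Hopf class for a dyadic Navier–Stokes model*, arXiv:2407.06179 (2024)
[`Palasek2024LerayHopfDyadic`]. A theorem about an infinite ODE system — **WHAT THIS IS NOT: not
Navier–Stokes** (the source, §1: "we restrict ourselves to the dyadic setting in which the PDE is
replaced by an infinite-dimensional ODE system"). The barrier
`Literature.Barriers.NavierStokesRegularity.DyadicCascadeRegularity` cites this theorem in prose only
(its scope_caveats); no declaration of it existed (`lean search Palasek2024LerayHopfDyadic`).

## What is printed (arXiv:2407.06179)

* (1.2) (system), §1: for an unknown `u : [0,∞) → ℝ^I`,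
  `∂ₜu_k + νN_k²u_k + B_k[u,u] = 0`, `u_k(0) = u_k⁰` for all `k ∈ I`, with
  `B_k[u,u] = −N_{k−1}^α u_{k−1}u_k + N_k^α u_{k+1}²`, `N_k = λ^k N₀` (`λ > 1`); "By rescaling, we
  normalize the viscosity `ν = 1`. Unless otherwise noted, we take the index set to be `I = ℕ`
  which models the Navier–Stokes on `Ω = 𝕋ᵈ`. In this case one closes the system by fixing
  `u_{−1} = 0`." §1.6: `ℕ ∋ 0`; `‖a‖_{H^s} = (Σ_k λ^{2sk}|a_k|²)^{1/2}`, `L² = H⁰`.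
* **Def. 1.1**: "For any initial data `u₀ ∈ L²`, we say that a solution `u(t)` of (system) on
  `[0,T]` is Leray–Hopf if it belongs to the space `L^∞_t L² ∩ L²_t H¹` and obeys the energy
  inequality `Σ_k u_k²(t)/2 + ∫₀ᵗ Σ_k N_k²u_k²(s) ds ≤ Σ_k (u_k⁰)²/2` for all `t ∈ [0,T]`."
  (Global Leray–Hopf solutions exist for every `L²` datum by Galerkin truncation.)
* **Thm. 1.2**: "For any `α ∈ (2,4)` and all sufficiently large `λ`, there exists initial data
  `u⁰ ∈ ∩_{s<α−2} H^s` that gives rise to two distinct Leray–Hopf solutions of (system)."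
* Rem. 1.3: `α > 2` expected sharp (`α < 2` subcritical, Picard); `α < 4` technical. **Rem. 1.4**:
  "The solutions `u, v` are non-negative … Moreover, for every `t > 0`, they decay exponentially in
  frequency: `u_k(t), v_k(t) ≲_λ N_k^{−α+2}e^{−N_k²t}`" (smooth for positive times). Rem. 1.7:
  `u_k⁰ ∼_λ N_k^{−α+2}`, the critical space `X^{α−2}` (Besov `B^{−1+2(α−1)/p}_{p,∞}` analogue).
  Rem. 1.8: the scenario is unstable (not an open set of data). §4 (end of proof): distinctness from
  the large-time asymptotics `v₁ ≲ δ₂e^{−2N₂²(t−τ₂)}` vs `u₁ ≍ δ₁e^{−N₁²(t−τ₁)}`; the energy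
  inequality from the truncated balance `d/dt Σ_{k≤m} u_k²/2 + Σ_{k≤m} N_k²u_k² = −N_m^α u_m u_{m+1}²
  ≤ 0` (`u_k ≥ 0`) and Fatou.

## Rendering (WEAKER than print)

* `ν = 1` and `N₀ = 1`, i.e. `N_k = λ^k` (printed normalisation of `ν`; `N₀` is scaled out by
  `u_k(t) ↦ μ^{2−α}u_k(μ²t)`, `N_k ↦ μN_k`, which preserves (system), the Leray–Hopf class and
  distinctness — we simply fix `N₀ = 1`, a case literally covered).
* The model right-hand side is the tree's `PalasekObukhov.obukhovRHS 1 α N (u(t)) 0 k`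
  (`= −N_k²u_k + N_{k−1}^α u_{k−1}u_k − N_k^α u_{k+1}²` with the convention `u_{−1} ≡ 0`, force `0`)
  — the unforced, geometric-scale (`N_k = λ^k`) member of the same Obukhov family whose forced
  super-lacunary member (`N_k = N₀^{b^k}`) is `Palasek2026_viscousBlowup`.
* "Solution on `[0,T]` … Leray–Hopf" (`PalasekObukhov.IsLerayHopfOn`): every mode `u_k` is
  continuous on `[0,T]` with `u_k(0) = u_k⁰` and satisfies the mode ODE classically on `(0,T)`
  (each mode equation involves three modes only; for an `L^∞_tL²` solution in the integrated sense
  every mode is `C¹`, so this is implied by any reasonable reading of "solution"); `L^∞_t L²`: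
  `Σ_k u_k(t)² ≤ C` on `[0,T]` (summable); `L²_t H¹`: `Σ_k N_k²u_k(t)²` summable for `t ∈ (0,T]` and
  integrable on `(0,T]`; the energy inequality for all `t ∈ [0,T]` with `∫_{(0,t]}`. All junk-free
  (summability / integrability demanded explicitly).
* Data class `∩_{s<α−2} H^s`: `Σ_k λ^{2sk}(u_k⁰)² < ∞` for every `s < α − 2` (real powers `rpow`).
* "two distinct Leray–Hopf solutions of (system)": global ones — Leray–Hopf on `[0,T]` for every
  `T > 0` (the printed solutions are constructed on all of `[0,∞)`, §2–§4) — differing at some mode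
  and some time `t > 0`; Rem. 1.4's non-negativity is recorded, its decay rate is not.

## References

* S. Palasek, *Non-uniqueness in the Leray–Hopf class for a dyadic Navier–Stokes model*,
  arXiv:2407.06179 (2024), (1.2), Def. 1.1, Thm. 1.2, Rem. 1.3–1.8, §1.6, §4. [`Palasek2024LerayHopfDyadic`]
* S. Palasek, *Finite-time blow-up in an elementary model of the 3D Navier–Stokes equations*,
  arXiv:2605.13827 (2026), §1.2 (the forced Obukhov model; tree `PalasekObukhovBlowup.lean`).
  [`Palasek2026ElementaryModel`]
* D. Barbato, F. Morandin, M. Romito, Trans. AMS 363 (2011), Thm. 1 (regularity of the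
  Katz–Pavlović cascade; tree barrier `DyadicCascadeRegularity`). [`BarbatoMorandinRomito2011`]
-/

noncomputable section

open MeasureTheory Set Filter

namespace Literature.Analysis.FluidPDE

namespace PalasekObukhov

/-- **Leray–Hopf solutions of the UNFORCED Obukhov model on `[0,T]`** (Palasek 2024, Def. 1.1 with
(1.2) at `ν = 1`, `u_{−1} ≡ 0`), for a scale sequence `N` and datum `u⁰`: every mode is continuous
on `[0,T]`, starts at `u⁰_k`, and solves `u_k' = −N_k²u_k + N_{k−1}^α u_{k−1}u_k − N_k^α u_{k+1}²`
(the tree's `obukhovRHS 1 α N · 0 k`) classically on `(0,T)`; `u ∈ L^∞(0,T; ℓ²)` (summable energy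
bounded on `[0,T]`), `u ∈ L²(0,T; H¹)` (`Σ N_k²u_k²` summable on `(0,T]` and integrable there), and
the ENERGY INEQUALITY `Σ_k u_k(t)²/2 + ∫_{(0,t]} Σ_k N_k²u_k(s)² ds ≤ Σ_k (u⁰_k)²/2` holds for every
`t ∈ [0,T]`. An ODE shell model — not Navier–Stokes. [cite: Palasek2024LerayHopfDyadic, Def. 1.1 with (1.2)] -/
def IsLerayHopfOn (α : ℝ) (N : ℕ → ℝ) (u0 : ℕ → ℝ) (u : ℕ → ℝ → ℝ) (T : ℝ) : Prop :=
  (∀ k, u k 0 = u0 k) ∧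
    (∀ k, ContinuousOn (u k) (Icc 0 T)) ∧
    (∀ k, ∀ t ∈ Ioo 0 T, HasDerivAt (u k) (obukhovRHS 1 α N (fun j => u j t) 0 k) t) ∧
    (∃ C : ℝ, ∀ t ∈ Icc 0 T, Summable (fun k => u k t ^ 2) ∧ ∑' k, u k t ^ 2 ≤ C) ∧
    (∀ t ∈ Ioc 0 T, Summable fun k => N k ^ 2 * u k t ^ 2) ∧
    IntegrableOn (fun t => ∑' k, N k ^ 2 * u k t ^ 2) (Ioc 0 T) ∧
    ∀ t ∈ Icc 0 T,
      (∑' k, u k t ^ 2) / 2 + ∫ s in Ioc 0 t, ∑' k, N k ^ 2 * u k s ^ 2 ≤ (∑' k, u0 k ^ 2) / 2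

/-- A Leray–Hopf solution takes the datum at time `0` (projection of the definition).
[cite: Palasek2024LerayHopfDyadic, Def. 1.1] -/
theorem IsLerayHopfOn.initial {α : ℝ} {N : ℕ → ℝ} {u0 : ℕ → ℝ} {u : ℕ → ℝ → ℝ} {T : ℝ}
    (h : IsLerayHopfOn α N u0 u T) (k : ℕ) : u k 0 = u0 k :=
  h.1 k

/-- A Leray–Hopf solution obeys the energy inequality from the datum (projection of the definition;
Palasek 2024, Def. 1.1 (energyinequality)). [cite: Palasek2024LerayHopfDyadic, Def. 1.1] -/
theorem IsLerayHopfOn.energy_ineq {α : ℝ} {N : ℕ → ℝ} {u0 : ℕ → ℝ} {u : ℕ → ℝ → ℝ} {T : ℝ}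
    (h : IsLerayHopfOn α N u0 u T) {t : ℝ} (ht : t ∈ Icc 0 T) :
    (∑' k, u k t ^ 2) / 2 + ∫ s in Ioc 0 t, ∑' k, N k ^ 2 * u k s ^ 2 ≤ (∑' k, u0 k ^ 2) / 2 :=
  h.2.2.2.2.2.2 t ht

end PalasekObukhov

open PalasekObukhov

/-- **Palasek 2024, Thm. 1.2 (with Rem. 1.4, first sentence): Leray–Hopf non-uniqueness for the
unforced dyadic Obukhov model** — rendering of the module docstring (`ν = 1`, `N_k = λ^k`). For
every `α ∈ (2,4)` there is `λ₀ > 1` such that for every `λ ≥ λ₀` there are a datum `u⁰` lying in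
`H^s` for every `s < α − 2` (`Σ_k λ^{2sk}(u⁰_k)² < ∞`) and two GLOBAL Leray–Hopf solutions `u`, `v`
of `u_k' = −N_k²u_k + N_{k−1}^α u_{k−1}u_k − N_k^α u_{k+1}²` from `u⁰` (Leray–Hopf on `[0,T]` for
every `T > 0`, `PalasekObukhov.IsLerayHopfOn`), both non-negative, which differ at some mode at
some positive time. A theorem about an ODE shell model, NOT about Navier–Stokes (Rem. 1.7: the
datum is critical, `u⁰_k ∼ N_k^{2−α}`; Rem. 1.8: the scenario is unstable).
[cite: Palasek2024LerayHopfDyadic, Thm. 1.2, Rem. 1.4, Def. 1.1] -/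
def Palasek2024_lerayHopfNonuniqueness : Prop :=
  ∀ α : ℝ, 2 < α → α < 4 →
    ∃ lam0 : ℝ, 1 < lam0 ∧ ∀ lam : ℝ, lam0 ≤ lam →
      ∃ (u0 : ℕ → ℝ) (u v : ℕ → ℝ → ℝ),
        (∀ s : ℝ, s < α - 2 → Summable fun k : ℕ => lam ^ (2 * s * (k : ℝ)) * u0 k ^ 2) ∧
        (∀ T : ℝ, 0 < T → IsLerayHopfOn α (fun k => lam ^ k) u0 u T) ∧
        (∀ T : ℝ, 0 < T → IsLerayHopfOn α (fun k => lam ^ k) u0 v T) ∧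
        (∀ (k : ℕ) (t : ℝ), 0 ≤ t → 0 ≤ u k t ∧ 0 ≤ v k t) ∧
        ∃ (k : ℕ) (t : ℝ), 0 < t ∧ u k t ≠ v k t

/-- **Reformulation: Leray–Hopf uniqueness FAILS for the unforced Obukhov model at `3`-dimensional
intermittency** (Palasek 2024, Thm. 1.2; §1: "the uniqueness of these solutions (without forcing)
for (system) or any other dyadic model … has been an open question up to this point" — answered
negatively). From the fact: it is not true that for every `α ∈ (2,4)`, every `λ > 1`, every datum and
every pair of global Leray–Hopf solutions from it, the two solutions coincide at all modes and all
positive times. [cite: Palasek2024LerayHopfDyadic, Thm. 1.2] -/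
theorem Palasek2024_lerayHopfNonuniqueness.not_unique (h : Palasek2024_lerayHopfNonuniqueness) :
    ¬ ∀ (α lam : ℝ) (u0 : ℕ → ℝ) (u v : ℕ → ℝ → ℝ), 2 < α → α < 4 → 1 < lam →
        (∀ T : ℝ, 0 < T → IsLerayHopfOn α (fun k => lam ^ k) u0 u T) →
        (∀ T : ℝ, 0 < T → IsLerayHopfOn α (fun k => lam ^ k) u0 v T) →
        ∀ (k : ℕ) (t : ℝ), 0 < t → u k t = v k t := by
  intro hyp
  obtain ⟨lam0, hlam0, hlam⟩ := h 3 (by norm_num) (by norm_num)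
  obtain ⟨u0, u, v, -, hu, hv, -, k, t, ht, hne⟩ := hlam lam0 le_rfl
  exact hne (hyp 3 lam0 u0 u v (by norm_num) (by norm_num) hlam0 hu hv k t ht)

end Literature.Analysis.FluidPDE
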